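import Literature.NumberTheory.Rogawski1990.ArchHyperbolicOrbitMeasureTransport   -- ★ p848923∕p848971: head (ii) under the (T2e) hypothesis + its transport; brings ★ p848650∕678∕DEAL #15 export
import HarnessLib

/-!
# The split-orbit quotient-volume bound `≤ C√R` UNCONDITIONALLY: the (T2e) hypothesis discharged by ★ `exists_measure_unitaryGroupOfForm_antidiag_two_eq_mul_prod_preimage_archPlaneLift`
# (head (ii) PART 4 of DEAL #11 «(VOL-split-measure)»; Beuzart-Plessis 2020 §1.2, §1.8)

Topic `NumberTheory/Rogawski1990`; namespace `Literature.NumberTheory.Rogawski1990`.  THEOREMS ONLY (no `def`, no instance, no notation, no axiom, no named fact,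
no `sorry`).  Cell `pub/hodgecm-mathlib`, crux H413 (`stmt-HodgeConjecture-24833`), F0∕P3c line LH3 kit, DEAL #11 of LH3-plan (g0) («consume (T2e) by name or as a
hypothesis»: ★ `ArchHyperbolicOrbitMeasure` took it as the hypothesis `hν`; LH3-p02's DEAL #15 = ED. 4 of ★ `ArchPlaneHaarHSBallLocal` exported it; this file CONSUMES IT
BY NAME); seat LH2-p04 (g2).

THE MATHEMATICS.  `G = U(Φ₂)(ℂ)`, `γ = diag(z₀a, z₀b)` split regular, `T = G_γ`, `ν` Haar on `G` (right∕inversion invariant), `ρ` Haar inversion-invariant on `T`,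
`μ = quotientMeasure T ρ _ ν`.
* §1 `coe_inv_eq_conjTranspose_sandwich` — on `G` the inverse is POLYNOMIAL: `g⁻¹ = Φ₂ ḡᵀ Φ₂`; so the orbit-ball ∩ slab `S′_R = {g ∣ Σ|(g⁻¹γg)_ij|² ≤ R, ½ ≤ |g₁₀|²+|g₁₁|² ≤ 1}`
  is the preimage of a CLOSED MATRIX SET `Smat_R ⊆ M₂(ℂ)` under `g ↦ (g : M₂(ℂ))` (`slabBall_eq_preimage`).
* §2 `quotientMeasure_hsOrbitBall_le_inv_mul_measure_slabBall` — steps 1–2 of the head, isolated: `μ(E_R) ≤ κ_T⁻¹ · ν(S′_R)` (★ engine §1-inv with the weight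
  `κ_T⁻¹ 1_SLAB`, right fibres ≡ 1 by ★ `measure_chi_Icc_eq`);  `measure_slabBall_le_of_haar` — by the ★ (T2e) export at `μ_{S¹} := haar`,
  `ν(S′_R) = κ · (haar ⊗ iwasawaMeasure){(z,r) ∣ lift(z,r) ∈ Smat_R} ≤ κ · haar(S¹) · 8π√R∕|a−b|` (★ engine §3, `det r = 1` a.e.);  hence
  **`exists_quotientMeasure_hsOrbitBall_le_sqrt_of_split_haar : ∃ C, ∀ R, μ(E_R) ≤ C √R`** with NO measure-identification hypothesis.
* (sequel ★ `ArchHyperbolicOrbitMeasureHaarTransport`: the transport re-run from this MODEL BOUND, whence the unconditional per-place statements in the (CONV)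
  assembler's `hplace` letters at a split place.)
Remaining hypotheses are instances only: `[LocallyCompactSpace G] [SecondCountableTopology G]` (★ `locallyCompactSpace∕secondCountableTopology_unitaryGroupOfForm_complex`)
and `[ν.IsInvInvariant]` (★ `isInvInvariant_of_isMulRightInvariant`).
HONEST LABEL: HC_CM is proved only modulo the 7 printed citations (2 remaining: hLiu418 = stmt-HodgeConjecture-24832, h413 = stmt-HodgeConjecture-24833) until rung 0
closes; count-neutral kit under the LETTERS O1∕O3 (`stub_N9`) and O1″∕O3″ (`stub_N8`).

## References
* [BeuzartPlessis2020Asterisque] R. Beuzart-Plessis, *A local trace formula for the Gan–Gross–Prasad conjecture for unitary groups: the archimedean case*,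
  Astérisque 418 (2020), §1.8 p. 39 (absolute convergence of Schwartz orbital integrals); §1.2 (1.2.2), (1.2.4) p. 21 (orbit-norm equivalence, Harish-Chandra's estimate).
* [Folland1995] G. B. Folland, *A Course in Abstract Harmonic Analysis* (1995), §2.6 Thm. 2.49.
* [Rogawski1990] J. D. Rogawski, *Automorphic Representations of Unitary Groups in Three Variables*, Ann. of Math. Stud. 123 (1990), §3.1 p. 19 (`U(Φ)`, `g⁻¹ = Φ⁻¹ ḡᵀ Φ`).
-/

set_option autoImplicit false

noncomputable section

open Complex MeasureTheory Set Literature.MeasureTheory.Group Literature.NumberTheory.Automorphic Literature.NumberTheory.Automorphic.UnitaryGroup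
open scoped Matrix ComplexConjugate NNReal ENNReal Real

namespace Literature.NumberTheory.Rogawski1990

/-! ## §1 The inverse on `U(Φ₂)(ℂ)` is polynomial; the slab-ball is a matrix preimage -/

section Polynomial

variable {γ : ↥(unitaryGroupOfForm (starRingEnd ℂ) (Matrix.of fun i j : Fin 2 => if i.val + j.val + 1 = 2 then (1 : ℂ) else 0))}

/-- On `U(Φ₂)(ℂ)` the inverse is `g⁻¹ = Φ₂ ḡᵀ Φ₂` (`ḡᵀ Φ₂ g = Φ₂`, `Φ₂² = 1`). [cite: Rogawski1990, §3.1 p. 19] -/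
theorem coe_inv_eq_conjTranspose_sandwich (g : ↥(unitaryGroupOfForm (starRingEnd ℂ) (Matrix.of fun i j : Fin 2 => if i.val + j.val + 1 = 2 then (1 : ℂ) else 0))) :
    (((g⁻¹ : ↥(unitaryGroupOfForm (starRingEnd ℂ) (Matrix.of fun i j : Fin 2 => if i.val + j.val + 1 = 2 then (1 : ℂ) else 0))) : GL (Fin 2) ℂ) : Matrix (Fin 2) (Fin 2) ℂ) = (Matrix.of fun i j : Fin 2 => if i.val + j.val + 1 = 2 then (1 : ℂ) else 0) * (((((g : ↥(unitaryGroupOfForm (starRingEnd ℂ) (Matrix.of fun i j : Fin 2 => if i.val + j.val + 1 = 2 then (1 : ℂ) else 0))) : GL (Fin 2) ℂ) : Matrix (Fin 2) (Fin 2) ℂ)).map (starRingEnd ℂ))ᵀ * (Matrix.of fun i j : Fin 2 => if i.val + j.val + 1 = 2 then (1 : ℂ) else 0) := by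
  rw [Subgroup.coe_inv, Matrix.coe_units_inv]
  apply Matrix.inv_eq_left_inv
  have hu := mem_unitaryGroupOfForm_iff.1 g.2
  have hΦ : (Matrix.of fun i j : Fin 2 => if i.val + j.val + 1 = 2 then (1 : ℂ) else 0) * (Matrix.of fun i j : Fin 2 => if i.val + j.val + 1 = 2 then (1 : ℂ) else 0) = (1 : Matrix (Fin 2) (Fin 2) ℂ) := by
    ext i j; fin_cases i <;> fin_cases j <;> simp [Matrix.mul_apply, Fin.sum_univ_two]
  calc (Matrix.of fun i j : Fin 2 => if i.val + j.val + 1 = 2 then (1 : ℂ) else 0) * (((((g : ↥(unitaryGroupOfForm (starRingEnd ℂ) (Matrix.of fun i j : Fin 2 => if i.val + j.val + 1 = 2 then (1 : ℂ) else 0))) : GL (Fin 2) ℂ) : Matrix (Fin 2) (Fin 2) ℂ)).map (starRingEnd ℂ))ᵀ * (Matrix.of fun i j : Fin 2 => if i.val + j.val + 1 = 2 then (1 : ℂ) else 0) * (((g : ↥(unitaryGroupOfForm (starRingEnd ℂ) (Matrix.of fun i j : Fin 2 => if i.val + j.val + 1 = 2 then (1 : ℂ) else 0))) : GL (Fin 2)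 ℂ) : Matrix (Fin 2) (Fin 2) ℂ)
      = (Matrix.of fun i j : Fin 2 => if i.val + j.val + 1 = 2 then (1 : ℂ) else 0) * ((((((g : ↥(unitaryGroupOfForm (starRingEnd ℂ) (Matrix.of fun i j : Fin 2 => if i.val + j.val + 1 = 2 then (1 : ℂ) else 0))) : GL (Fin 2) ℂ) : Matrix (Fin 2) (Fin 2) ℂ)).map (starRingEnd ℂ))ᵀ * (Matrix.of fun i j : Fin 2 => if i.val + j.val + 1 = 2 then (1 : ℂ) else 0) * (((g : ↥(unitaryGroupOfForm (starRingEnd ℂ) (Matrix.of fun i j : Fin 2 => if i.val + j.val + 1 = 2 then (1 : ℂ) else 0))) : GL (Fin 2) ℂ) : Matrix (Fin 2) (Fin 2) ℂ)) := by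
        simp only [Matrix.mul_assoc]
    _ = 1 := by rw [hu, hΦ]

/-- The HS radius of `g⁻¹γg` as a CONTINUOUS function of the matrix of `g`: `Σ|(g⁻¹γg)_ij|² = Σ|(Φ₂ ḡᵀ Φ₂ γ g)_ij|²`. [cite: Rogawski1990, §3.1 p. 19] -/
theorem hs_inv_conj_eq_sandwich (g : ↥(unitaryGroupOfForm (starRingEnd ℂ) (Matrix.of fun i j : Fin 2 => if i.val + j.val + 1 = 2 then (1 : ℂ) else 0))) :
    ∑ i : Fin 2, ∑ j : Fin 2, ‖(((g⁻¹ * γ * g : ↥(unitaryGroupOfForm (starRingEnd ℂ) (Matrix.of fun i j : Fin 2 => if i.val + j.val + 1 = 2 then (1 : ℂ) else 0))) : GL (Fin 2) ℂ) : Matrix (Fin 2) (Fin 2) ℂ) i j‖ ^ 2 =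
      ∑ i : Fin 2, ∑ j : Fin 2, ‖(((Matrix.of fun i j : Fin 2 => if i.val + j.val + 1 = 2 then (1 : ℂ) else 0) * (((((g : ↥(unitaryGroupOfForm (starRingEnd ℂ) (Matrix.of fun i j : Fin 2 => if i.val + j.val + 1 = 2 then (1 : ℂ) else 0))) : GL (Fin 2) ℂ) : Matrix (Fin 2) (Fin 2) ℂ)).map (starRingEnd ℂ))ᵀ * (Matrix.of fun i j : Fin 2 => if i.val + j.val + 1 = 2 then (1 : ℂ) else 0) * (((γ : ↥(unitaryGroupOfForm (starRingEnd ℂ) (Matrix.of fun i j : Fin 2 => if i.val + j.val + 1 = 2 then (1 : ℂ) else 0))) : GL (Fin 2) ℂ) : Matrix (Fin 2) (Fin 2) ℂ) * (((g : ↥(unitaryGroupOfForm (starRingEnd ℂ) (Matrix.of fun i j : Fin 2 => if i.val + j.val + 1 = 2 then (1 : ℂ) else 0))) : GL (Fin 2) ℂ) : Matrix (Fin 2) (Fin 2) ℂ) : Matrix (Fin 2) (Fin 2) ℂ)) i j‖ ^ 2 := by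
  rw [← coe_inv_eq_conjTranspose_sandwich g]
  simp only [Subgroup.coe_mul, Units.val_mul]

end Polynomial

/-! ## §2 Steps 1–2 isolated, the slab-ball through the (T2e) export, and the unconditional head -/

section Head

variable [MeasurableSpace (Matrix (Fin 2) (Fin 2) ℝ)] [BorelSpace (Matrix (Fin 2) (Fin 2) ℝ)] [MeasurableSpace Circle] [BorelSpace Circle]
  [MeasurableSpace (Matrix (Fin 2) (Fin 2) ℂ)] [BorelSpace (Matrix (Fin 2) (Fin 2) ℂ)]
  [MeasurableSpace ↥(unitaryGroupOfForm (starRingEnd ℂ) (Matrix.of fun i j : Fin 2 => if i.val + j.val + 1 = 2 then (1 : ℂ) else 0))] [BorelSpace ↥(unitaryGroupOfForm (starRingEnd ℂ) (Matrix.of fun i j : Fin 2 => if i.val + j.val + 1 = 2 then (1 : ℂ) else 0))]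
  [LocallyCompactSpace ↥(unitaryGroupOfForm (starRingEnd ℂ) (Matrix.of fun i j : Fin 2 => if i.val + j.val + 1 = 2 then (1 : ℂ) else 0))] [SecondCountableTopology ↥(unitaryGroupOfForm (starRingEnd ℂ) (Matrix.of fun i j : Fin 2 => if i.val + j.val + 1 = 2 then (1 : ℂ) else 0))]
  {γ : ↥(unitaryGroupOfForm (starRingEnd ℂ) (Matrix.of fun i j : Fin 2 => if i.val + j.val + 1 = 2 then (1 : ℂ) else 0))}

omit [MeasurableSpace (Matrix (Fin 2) (Fin 2) ℝ)] [BorelSpace (Matrix (Fin 2) (Fin 2) ℝ)] [MeasurableSpace Circle] [BorelSpace Circle]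
  [MeasurableSpace (Matrix (Fin 2) (Fin 2) ℂ)] [BorelSpace (Matrix (Fin 2) (Fin 2) ℂ)] in
/-- **STEPS 1–2 OF THE HEAD, ISOLATED**: `μ_{G⧸T}(E_R) ≤ κ_T⁻¹ · ν{g ∣ Σ|(g⁻¹γg)_ij|² ≤ R, ½ ≤ |g₁₀|² + |g₁₁|² ≤ 1}` — ★ `quotientMeasure_le_lintegral_inv_of_one_le` with the weight
`κ_T⁻¹ · 1_SLAB`, whose right `T`-fibres are `≡ 1` (★ `measure_chi_Icc_eq`). [cite: BeuzartPlessis2020Asterisque, §1.8 p. 39; §1.2 (1.2.2), (1.2.4) p. 21] [cite: Folland1995, §2.6 Thm. 2.49] -/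
theorem quotientMeasure_hsOrbitBall_le_inv_mul_measure_slabBall
    {z₀ : ℂ} {a b : ℝ} (hγ : (((γ : ↥(unitaryGroupOfForm (starRingEnd ℂ) (Matrix.of fun i j : Fin 2 => if i.val + j.val + 1 = 2 then (1 : ℂ) else 0))) : GL (Fin 2) ℂ) : Matrix (Fin 2) (Fin 2) ℂ) = !![z₀ * a, 0; 0, z₀ * b]) (hz₀ : ‖z₀‖ = 1) (hab : a ≠ b)
    (ν : Measure ↥(unitaryGroupOfForm (starRingEnd ℂ) (Matrix.of fun i j : Fin 2 => if i.val + j.val + 1 = 2 then (1 : ℂ) else 0))) [ν.IsHaarMeasure] [ν.IsMulRightInvariant] [ν.IsInvInvariant]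
    (ρ : Measure ↥(Subgroup.centralizer ({γ} : Set ↥(unitaryGroupOfForm (starRingEnd ℂ) (Matrix.of fun i j : Fin 2 => if i.val + j.val + 1 = 2 then (1 : ℂ) else 0))))) [ρ.IsHaarMeasure] [ρ.IsInvInvariant]
    [MeasurableSpace (↥(unitaryGroupOfForm (starRingEnd ℂ) (Matrix.of fun i j : Fin 2 => if i.val + j.val + 1 = 2 then (1 : ℂ) else 0)) ⧸ Subgroup.centralizer ({γ} : Set ↥(unitaryGroupOfForm (starRingEnd ℂ) (Matrix.of fun i j : Fin 2 => if i.val + j.val + 1 = 2 then (1 : ℂ) else 0))))] [BorelSpace (↥(unitaryGroupOfForm (starRingEnd ℂ) (Matrix.of fun i j : Fin 2 => if i.val + j.val + 1 = 2 then (1 : ℂ) else 0)) ⧸ Subgroup.centralizer ({γ} : Set ↥(unitaryGroupOfForm (starRingEnd ℂ) (Matrix.of fun i j : Fin 2 => if i.val + j.val + 1 = 2 then (1 : ℂ) else 0))))] (R : ℝ) :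
    quotientMeasure (Subgroup.centralizer ({γ} : Set ↥(unitaryGroupOfForm (starRingEnd ℂ) (Matrix.of fun i j : Fin 2 => if i.val + j.val + 1 = 2 then (1 : ℂ) else 0)))) ρ (Set.isClosed_centralizer ({γ} : Set ↥(unitaryGroupOfForm (starRingEnd ℂ) (Matrix.of fun i j : Fin 2 => if i.val + j.val + 1 = 2 then (1 : ℂ) else 0)))) ν
        {x | ∑ i : Fin 2, ∑ j : Fin 2, ‖(((x.out * γ * x.out⁻¹ : ↥(unitaryGroupOfForm (starRingEnd ℂ) (Matrix.of fun i j : Fin 2 => if i.val + j.val + 1 = 2 then (1 : ℂ) else 0))) : GL (Fin 2) ℂ) : Matrix (Fin 2) (Fin 2) ℂ) i j‖ ^ 2 ≤ R} ≤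
      (ρ {t | ‖(((((t : ↥(Subgroup.centralizer ({γ} : Set ↥(unitaryGroupOfForm (starRingEnd ℂ) (Matrix.of fun i j : Fin 2 => if i.val + j.val + 1 = 2 then (1 : ℂ) else 0))))) : ↥(unitaryGroupOfForm (starRingEnd ℂ) (Matrix.of fun i j : Fin 2 => if i.val + j.val + 1 = 2 then (1 : ℂ) else 0))) : ↥(unitaryGroupOfForm (starRingEnd ℂ) (Matrix.of fun i j : Fin 2 => if i.val + j.val + 1 = 2 then (1 : ℂ) else 0))) : GL (Fin 2) ℂ) : Matrix (Fin 2) (Fin 2) ℂ) 1 1‖ ^ 2 ∈ Icc 1 2})⁻¹ *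
        ν ({g | ∑ i : Fin 2, ∑ j : Fin 2, ‖(((g⁻¹ * γ * g : ↥(unitaryGroupOfForm (starRingEnd ℂ) (Matrix.of fun i j : Fin 2 => if i.val + j.val + 1 = 2 then (1 : ℂ) else 0))) : GL (Fin 2) ℂ) : Matrix (Fin 2) (Fin 2) ℂ) i j‖ ^ 2 ≤ R} ∩
           {g | 1 / 2 ≤ ‖(((g : ↥(unitaryGroupOfForm (starRingEnd ℂ) (Matrix.of fun i j : Fin 2 => if i.val + j.val + 1 = 2 then (1 : ℂ) else 0))) : GL (Fin 2) ℂ) : Matrix (Fin 2) (Fin 2) ℂ) 1 0‖ ^ 2 + ‖(((g : ↥(unitaryGroupOfForm (starRingEnd ℂ) (Matrix.of fun i j : Fin 2 => if i.val + j.val + 1 = 2 then (1 : ℂ) else 0))) : GL (Fin 2) ℂ) : Matrix (Fin 2) (Fin 2) ℂ) 1 1‖ ^ 2 ∧ ‖(((g : ↥(unitaryGroupOfForm (starRingEnd ℂ) (Matrix.of fun i j : Fin 2 => if i.val + j.val + 1 = 2 then (1 : ℂ) else 0))) : GL (Fin 2) ℂ) : Matrix (Fin 2) (Fin 2) ℂ)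 1 0‖ ^ 2 + ‖(((g : ↥(unitaryGroupOfForm (starRingEnd ℂ) (Matrix.of fun i j : Fin 2 => if i.val + j.val + 1 = 2 then (1 : ℂ) else 0))) : GL (Fin 2) ℂ) : Matrix (Fin 2) (Fin 2) ℂ) 1 1‖ ^ 2 ≤ 1}) := by
  haveI hT : IsClosed ((Subgroup.centralizer ({γ} : Set ↥(unitaryGroupOfForm (starRingEnd ℂ) (Matrix.of fun i j : Fin 2 => if i.val + j.val + 1 = 2 then (1 : ℂ) else 0)))) : Set ↥(unitaryGroupOfForm (starRingEnd ℂ) (Matrix.of fun i j : Fin 2 => if i.val + j.val + 1 = 2 then (1 : ℂ) else 0))) := Set.isClosed_centralizer _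
  have hz₀' : z₀ ≠ 0 := by
    intro h; rw [h, norm_zero] at hz₀; exact zero_ne_one hz₀
  -- continuity of the matrix coefficients on `G`
  have hv : Continuous fun u : ↥(unitaryGroupOfForm (starRingEnd ℂ) (Matrix.of fun i j : Fin 2 => if i.val + j.val + 1 = 2 then (1 : ℂ) else 0)) => (((u : ↥(unitaryGroupOfForm (starRingEnd ℂ) (Matrix.of fun i j : Fin 2 => if i.val + j.val + 1 = 2 then (1 : ℂ) else 0))) : GL (Fin 2) ℂ) : Matrix (Fin 2) (Fin 2) ℂ) := Units.continuous_val.comp continuous_subtype_val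
  have hent : ∀ i j : Fin 2, Continuous fun u : ↥(unitaryGroupOfForm (starRingEnd ℂ) (Matrix.of fun i j : Fin 2 => if i.val + j.val + 1 = 2 then (1 : ℂ) else 0)) => (((u : ↥(unitaryGroupOfForm (starRingEnd ℂ) (Matrix.of fun i j : Fin 2 => if i.val + j.val + 1 = 2 then (1 : ℂ) else 0))) : GL (Fin 2) ℂ) : Matrix (Fin 2) (Fin 2) ℂ) i j := fun i j => (continuous_apply j).comp ((continuous_apply i).comp hv)
  -- the torus constant
  set κ : ℝ≥0∞ := ρ {t | ‖(((((t : ↥(Subgroup.centralizer ({γ} : Set ↥(unitaryGroupOfForm (starRingEnd ℂ) (Matrix.of fun i j : Fin 2 => if i.val + j.val + 1 = 2 then (1 : ℂ) else 0))))) : ↥(unitaryGroupOfForm (starRingEnd ℂ) (Matrix.of fun i j : Fin 2 => if i.val + j.val + 1 = 2 then (1 : ℂ) else 0))) : ↥(unitaryGroupOfForm (starRingEnd ℂ) (Matrix.of fun i j : Fin 2 => if i.val + j.val + 1 = 2 then (1 : ℂ) else 0))) : GL (Fin 2) ℂ) : Matrix (Fin 2) (Fin 2) ℂ) 1 1‖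 ^ 2 ∈ Icc 1 2} with hκ
  have hκ0 : κ ≠ 0 := measure_chi_Icc_ne_zero hγ ρ
  have hκtop : κ ≠ ⊤ := (measure_chi_Icc_lt_top hγ hz₀' hab ρ).ne
  -- the slab and the weight
  set SLAB : Set ↥(unitaryGroupOfForm (starRingEnd ℂ) (Matrix.of fun i j : Fin 2 => if i.val + j.val + 1 = 2 then (1 : ℂ) else 0)) := {g | 1 / 2 ≤ ‖(((g : ↥(unitaryGroupOfForm (starRingEnd ℂ) (Matrix.of fun i j : Fin 2 => if i.val + j.val + 1 = 2 then (1 : ℂ) else 0))) : GL (Fin 2) ℂ) : Matrix (Fin 2) (Fin 2) ℂ) 1 0‖ ^ 2 + ‖(((g : ↥(unitaryGroupOfForm (starRingEnd ℂ) (Matrix.of fun i j : Fin 2 => if i.val + j.val + 1 = 2 then (1 : ℂ) else 0))) : GL (Fin 2) ℂ) : Matrix (Fin 2) (Fin 2) ℂ) 1 1‖ ^ 2 ∧ ‖(((g : ↥(unitaryGroupOfForm (starRingEnd ℂ) (Matrix.of fun i j : Fin 2 => if i.val + j.val + 1 = 2 then (1 : ℂ) else 0))) : GL (Fin 2) ℂ)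 : Matrix (Fin 2) (Fin 2) ℂ) 1 0‖ ^ 2 + ‖(((g : ↥(unitaryGroupOfForm (starRingEnd ℂ) (Matrix.of fun i j : Fin 2 => if i.val + j.val + 1 = 2 then (1 : ℂ) else 0))) : GL (Fin 2) ℂ) : Matrix (Fin 2) (Fin 2) ℂ) 1 1‖ ^ 2 ≤ 1} with hSLAB
  have hrow : Continuous fun g : ↥(unitaryGroupOfForm (starRingEnd ℂ) (Matrix.of fun i j : Fin 2 => if i.val + j.val + 1 = 2 then (1 : ℂ) else 0)) => ‖(((g : ↥(unitaryGroupOfForm (starRingEnd ℂ) (Matrix.of fun i j : Fin 2 => if i.val + j.val + 1 = 2 then (1 : ℂ) else 0))) : GL (Fin 2) ℂ) : Matrix (Fin 2) (Fin 2) ℂ) 1 0‖ ^ 2 + ‖(((g : ↥(unitaryGroupOfForm (starRingEnd ℂ) (Matrix.of fun i j : Fin 2 => if i.val + j.val + 1 = 2 then (1 : ℂ) else 0))) : GL (Fin 2) ℂ) : Matrix (Fin 2) (Fin 2) ℂ) 1 1‖ ^ 2 :=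
    (((hent 1 0).norm).pow 2).add (((hent 1 1).norm).pow 2)
  have hSLABm : MeasurableSet SLAB :=
    ((isClosed_le continuous_const hrow).inter (isClosed_le hrow continuous_const)).measurableSet
  set ψ : ↥(unitaryGroupOfForm (starRingEnd ℂ) (Matrix.of fun i j : Fin 2 => if i.val + j.val + 1 = 2 then (1 : ℂ) else 0)) → ℝ≥0∞ := fun g => κ⁻¹ * SLAB.indicator 1 g with hψ
  have hψm : Measurable ψ := measurable_const.mul (measurable_const.indicator hSLABm)
  -- RIGHT FIBRES OF THE WEIGHT ARE ONE
  have hfib : ∀ g : ↥(unitaryGroupOfForm (starRingEnd ℂ) (Matrix.of fun i j : Fin 2 => if i.val + j.val + 1 = 2 then (1 : ℂ) else 0)), 1 ≤ ∫⁻ t : ↥(Subgroup.centralizer ({γ} : Set ↥(unitaryGroupOfForm (starRingEnd ℂ) (Matrix.of fun i j : Fin 2 => if i.val + j.val + 1 = 2 then (1 : ℂ) else 0)))), ψ ((t : ↥(unitaryGroupOfForm (starRingEnd ℂ) (Matrix.of fun i j : Fin 2 => if i.val + j.val + 1 = 2 then (1 : ℂ) else 0))) * g) ∂ρ := by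
    intro g
    -- the second row of an invertible matrix is non-zero
    have hs : 0 < ‖(((g : ↥(unitaryGroupOfForm (starRingEnd ℂ) (Matrix.of fun i j : Fin 2 => if i.val + j.val + 1 = 2 then (1 : ℂ) else 0))) : GL (Fin 2) ℂ) : Matrix (Fin 2) (Fin 2) ℂ) 1 0‖ ^ 2 + ‖(((g : ↥(unitaryGroupOfForm (starRingEnd ℂ) (Matrix.of fun i j : Fin 2 => if i.val + j.val + 1 = 2 then (1 : ℂ) else 0))) : GL (Fin 2) ℂ) : Matrix (Fin 2) (Fin 2) ℂ) 1 1‖ ^ 2 := by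
      by_contra hle
      have h0 : ‖(((g : ↥(unitaryGroupOfForm (starRingEnd ℂ) (Matrix.of fun i j : Fin 2 => if i.val + j.val + 1 = 2 then (1 : ℂ) else 0))) : GL (Fin 2) ℂ) : Matrix (Fin 2) (Fin 2) ℂ) 1 0‖ ^ 2 + ‖(((g : ↥(unitaryGroupOfForm (starRingEnd ℂ) (Matrix.of fun i j : Fin 2 => if i.val + j.val + 1 = 2 then (1 : ℂ) else 0))) : GL (Fin 2) ℂ) : Matrix (Fin 2) (Fin 2) ℂ) 1 1‖ ^ 2 = 0 := le_antisymm (not_lt.1 hle) (by positivity)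
      have h10 : (((g : ↥(unitaryGroupOfForm (starRingEnd ℂ) (Matrix.of fun i j : Fin 2 => if i.val + j.val + 1 = 2 then (1 : ℂ) else 0))) : GL (Fin 2) ℂ) : Matrix (Fin 2) (Fin 2) ℂ) 1 0 = 0 := by
        have : ‖(((g : ↥(unitaryGroupOfForm (starRingEnd ℂ) (Matrix.of fun i j : Fin 2 => if i.val + j.val + 1 = 2 then (1 : ℂ) else 0))) : GL (Fin 2) ℂ) : Matrix (Fin 2) (Fin 2) ℂ) 1 0‖ ^ 2 = 0 := by nlinarith [sq_nonneg ‖(((g : ↥(unitaryGroupOfForm (starRingEnd ℂ) (Matrix.of fun i j : Fin 2 => if i.val + j.val + 1 = 2 then (1 : ℂ) else 0))) : GL (Fin 2) ℂ) : Matrix (Fin 2) (Fin 2) ℂ) 1 0‖, sq_nonneg ‖(((g : ↥(unitaryGroupOfForm (starRingEnd ℂ) (Matrix.of fun i j : Fin 2 => if i.val + j.val + 1 = 2 then (1 : ℂ) else 0))) : GL (Fin 2) ℂ) : Matrix (Fin 2) (Fin 2) ℂ) 1 1‖]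
        exact norm_eq_zero.1 (pow_eq_zero_iff two_ne_zero |>.1 this)
      have h11 : (((g : ↥(unitaryGroupOfForm (starRingEnd ℂ) (Matrix.of fun i j : Fin 2 => if i.val + j.val + 1 = 2 then (1 : ℂ) else 0))) : GL (Fin 2) ℂ) : Matrix (Fin 2) (Fin 2) ℂ) 1 1 = 0 := by
        have : ‖(((g : ↥(unitaryGroupOfForm (starRingEnd ℂ) (Matrix.of fun i j : Fin 2 => if i.val + j.val + 1 = 2 then (1 : ℂ) else 0))) : GL (Fin 2) ℂ) : Matrix (Fin 2) (Fin 2) ℂ) 1 1‖ ^ 2 = 0 := by nlinarith [sq_nonneg ‖(((g : ↥(unitaryGroupOfForm (starRingEnd ℂ) (Matrix.of fun i j : Fin 2 => if i.val + j.val + 1 = 2 then (1 : ℂ) else 0))) : GL (Fin 2) ℂ) : Matrix (Fin 2) (Fin 2) ℂ) 1 0‖, sq_nonneg ‖(((g : ↥(unitaryGroupOfForm (starRingEnd ℂ) (Matrix.of fun i j : Fin 2 => if i.val + j.val + 1 = 2 then (1 : ℂ) else 0))) : GL (Fin 2) ℂ) : Matrix (Fin 2) (Fin 2) ℂ) 1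 1‖]
        exact norm_eq_zero.1 (pow_eq_zero_iff two_ne_zero |>.1 this)
      have hdet : ((((g : ↥(unitaryGroupOfForm (starRingEnd ℂ) (Matrix.of fun i j : Fin 2 => if i.val + j.val + 1 = 2 then (1 : ℂ) else 0))) : GL (Fin 2) ℂ) : Matrix (Fin 2) (Fin 2) ℂ)).det ≠ 0 :=
        ((Matrix.isUnit_iff_isUnit_det _).1 (g : GL (Fin 2) ℂ).isUnit).ne_zero
      apply hdet
      rw [Matrix.det_fin_two, h10, h11, mul_zero, mul_zero, sub_zero]
    -- the fibre set is a `χ`-shell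
    set s : ℝ := ‖(((g : ↥(unitaryGroupOfForm (starRingEnd ℂ) (Matrix.of fun i j : Fin 2 => if i.val + j.val + 1 = 2 then (1 : ℂ) else 0))) : GL (Fin 2) ℂ) : Matrix (Fin 2) (Fin 2) ℂ) 1 0‖ ^ 2 + ‖(((g : ↥(unitaryGroupOfForm (starRingEnd ℂ) (Matrix.of fun i j : Fin 2 => if i.val + j.val + 1 = 2 then (1 : ℂ) else 0))) : GL (Fin 2) ℂ) : Matrix (Fin 2) (Fin 2) ℂ) 1 1‖ ^ 2 with hsdef
    have hpre : (fun t : ↥(Subgroup.centralizer ({γ} : Set ↥(unitaryGroupOfForm (starRingEnd ℂ) (Matrix.of fun i j : Fin 2 => if i.val + j.val + 1 = 2 then (1 : ℂ) else 0)))) => (t : ↥(unitaryGroupOfForm (starRingEnd ℂ) (Matrix.of fun i j : Fin 2 => if i.val + j.val + 1 = 2 then (1 : ℂ) else 0))) * g) ⁻¹' SLAB = {t | ‖(((((t : ↥(Subgroup.centralizer ({γ} : Set ↥(unitaryGroupOfForm (starRingEnd ℂ) (Matrix.of fun i j : Fin 2 => if i.val + j.val + 1 = 2 then (1 : ℂ)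 else 0))))) : ↥(unitaryGroupOfForm (starRingEnd ℂ) (Matrix.of fun i j : Fin 2 => if i.val + j.val + 1 = 2 then (1 : ℂ) else 0))) : ↥(unitaryGroupOfForm (starRingEnd ℂ) (Matrix.of fun i j : Fin 2 => if i.val + j.val + 1 = 2 then (1 : ℂ) else 0))) : GL (Fin 2) ℂ) : Matrix (Fin 2) (Fin 2) ℂ) 1 1‖ ^ 2 ∈ Icc (1 / (2 * s)) (2 * (1 / (2 * s)))} := by
      ext t
      simp only [Set.mem_preimage, hSLAB, Set.mem_setOf_eq, Set.mem_Icc]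
      have e10 : ‖(((((t : ↥(Subgroup.centralizer ({γ} : Set ↥(unitaryGroupOfForm (starRingEnd ℂ) (Matrix.of fun i j : Fin 2 => if i.val + j.val + 1 = 2 then (1 : ℂ) else 0))))) : ↥(unitaryGroupOfForm (starRingEnd ℂ) (Matrix.of fun i j : Fin 2 => if i.val + j.val + 1 = 2 then (1 : ℂ) else 0))) * g : ↥(unitaryGroupOfForm (starRingEnd ℂ) (Matrix.of fun i j : Fin 2 => if i.val + j.val + 1 = 2 then (1 : ℂ) else 0))) : GL (Fin 2) ℂ) : Matrix (Fin 2) (Fin 2) ℂ) 1 0‖ ^ 2 = ‖(((((t : ↥(Subgroup.centralizer ({γ} : Set ↥(unitaryGroupOfForm (starRingEnd ℂ) (Matrix.of fun i j : Fin 2 => if i.val + j.val + 1 = 2 then (1 : ℂ) else 0))))) : ↥(unitaryGroupOfForm (starRingEnd ℂ) (Matrix.of fun i j : Fin 2 => if i.val + j.val + 1 = 2 then (1 : ℂ) else 0))) : ↥(unitaryGroupOfForm (starRingEnd ℂ) (Matrix.of fun i j : Fin 2 => if i.val + j.val + 1 = 2 then (1 : ℂ) else 0))) : GL (Fin 2)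 ℂ) : Matrix (Fin 2) (Fin 2) ℂ) 1 1‖ ^ 2 * ‖(((g : ↥(unitaryGroupOfForm (starRingEnd ℂ) (Matrix.of fun i j : Fin 2 => if i.val + j.val + 1 = 2 then (1 : ℂ) else 0))) : GL (Fin 2) ℂ) : Matrix (Fin 2) (Fin 2) ℂ) 1 0‖ ^ 2 := by
        rw [mul_apply_one_of_mem_centralizer hγ hz₀' hab t.2 g 0, norm_mul, mul_pow]
      have e11 : ‖(((((t : ↥(Subgroup.centralizer ({γ} : Set ↥(unitaryGroupOfForm (starRingEnd ℂ) (Matrix.of fun i j : Fin 2 => if i.val + j.val + 1 = 2 then (1 : ℂ) else 0))))) : ↥(unitaryGroupOfForm (starRingEnd ℂ) (Matrix.of fun i j : Fin 2 => if i.val + j.val + 1 = 2 then (1 : ℂ) else 0))) * g : ↥(unitaryGroupOfForm (starRingEnd ℂ) (Matrix.of fun i j : Fin 2 => if i.val + j.val + 1 = 2 then (1 : ℂ) else 0))) : GL (Fin 2) ℂ) : Matrix (Fin 2) (Fin 2) ℂ) 1 1‖ ^ 2 = ‖(((((t : ↥(Subgroup.centralizer ({γ} : Set ↥(unitaryGroupOfForm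 (starRingEnd ℂ) (Matrix.of fun i j : Fin 2 => if i.val + j.val + 1 = 2 then (1 : ℂ) else 0))))) : ↥(unitaryGroupOfForm (starRingEnd ℂ) (Matrix.of fun i j : Fin 2 => if i.val + j.val + 1 = 2 then (1 : ℂ) else 0))) : ↥(unitaryGroupOfForm (starRingEnd ℂ) (Matrix.of fun i j : Fin 2 => if i.val + j.val + 1 = 2 then (1 : ℂ) else 0))) : GL (Fin 2) ℂ) : Matrix (Fin 2) (Fin 2) ℂ) 1 1‖ ^ 2 * ‖(((g : ↥(unitaryGroupOfForm (starRingEnd ℂ) (Matrix.of fun i j : Fin 2 => if i.val + j.val + 1 = 2 then (1 : ℂ) else 0))) : GL (Fin 2) ℂ) : Matrix (Fin 2) (Fin 2) ℂ) 1 1‖ ^ 2 := by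
        rw [mul_apply_one_of_mem_centralizer hγ hz₀' hab t.2 g 1, norm_mul, mul_pow]
      rw [e10, e11, ← mul_add, ← hsdef]
      have h2s : (2 * (1 / (2 * s))) = 1 / s := by field_simp
      rw [h2s]
      constructor
      · rintro ⟨h1, h2⟩
        exact ⟨by rw [div_le_iff₀ (by positivity)]; linarith, by rw [le_div_iff₀ hs]; linarith⟩
      · rintro ⟨h1, h2⟩
        rw [div_le_iff₀ (by positivity)] at h1
        rw [le_div_iff₀ hs] at h2
        exact ⟨by linarith, by linarith⟩
    have hpm : MeasurableSet ((fun t : ↥(Subgroup.centralizer ({γ} : Set ↥(unitaryGroupOfForm (starRingEnd ℂ) (Matrix.of fun i j : Fin 2 => if i.val + j.val + 1 = 2 then (1 : ℂ) else 0)))) => (t : ↥(unitaryGroupOfForm (starRingEnd ℂ) (Matrix.of fun i j : Fin 2 => if i.val + j.val + 1 = 2 then (1 : ℂ) else 0))) * g) ⁻¹' SLAB) :=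
      (continuous_subtype_val.mul continuous_const).measurable hSLABm
    have hind : (fun t : ↥(Subgroup.centralizer ({γ} : Set ↥(unitaryGroupOfForm (starRingEnd ℂ) (Matrix.of fun i j : Fin 2 => if i.val + j.val + 1 = 2 then (1 : ℂ) else 0)))) => SLAB.indicator (1 : ↥(unitaryGroupOfForm (starRingEnd ℂ) (Matrix.of fun i j : Fin 2 => if i.val + j.val + 1 = 2 then (1 : ℂ) else 0)) → ℝ≥0∞) ((t : ↥(unitaryGroupOfForm (starRingEnd ℂ) (Matrix.of fun i j : Fin 2 => if i.val + j.val + 1 = 2 then (1 : ℂ) else 0))) * g)) =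
        ((fun t : ↥(Subgroup.centralizer ({γ} : Set ↥(unitaryGroupOfForm (starRingEnd ℂ) (Matrix.of fun i j : Fin 2 => if i.val + j.val + 1 = 2 then (1 : ℂ) else 0)))) => (t : ↥(unitaryGroupOfForm (starRingEnd ℂ) (Matrix.of fun i j : Fin 2 => if i.val + j.val + 1 = 2 then (1 : ℂ) else 0))) * g) ⁻¹' SLAB).indicator 1 := by
      funext t
      by_cases ht : (t : ↥(unitaryGroupOfForm (starRingEnd ℂ) (Matrix.of fun i j : Fin 2 => if i.val + j.val + 1 = 2 then (1 : ℂ) else 0))) * g ∈ SLAB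
      · rw [Set.indicator_of_mem ht, Set.indicator_of_mem (show t ∈ (fun t : ↥(Subgroup.centralizer ({γ} : Set ↥(unitaryGroupOfForm (starRingEnd ℂ) (Matrix.of fun i j : Fin 2 => if i.val + j.val + 1 = 2 then (1 : ℂ) else 0)))) => (t : ↥(unitaryGroupOfForm (starRingEnd ℂ) (Matrix.of fun i j : Fin 2 => if i.val + j.val + 1 = 2 then (1 : ℂ) else 0))) * g) ⁻¹' SLAB from ht)]
        rfl
      · rw [Set.indicator_of_notMem ht, Set.indicator_of_notMem (show t ∉ (fun t : ↥(Subgroup.centralizer ({γ} : Set ↥(unitaryGroupOfForm (starRingEnd ℂ) (Matrix.of fun i j : Fin 2 => if i.val + j.val + 1 = 2 then (1 : ℂ) else 0)))) => (t : ↥(unitaryGroupOfForm (starRingEnd ℂ) (Matrix.of fun i j : Fin 2 => if i.val + j.val + 1 = 2 then (1 : ℂ) else 0))) * g) ⁻¹' SLAB from ht)]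
    have hcalc : ∫⁻ t : ↥(Subgroup.centralizer ({γ} : Set ↥(unitaryGroupOfForm (starRingEnd ℂ) (Matrix.of fun i j : Fin 2 => if i.val + j.val + 1 = 2 then (1 : ℂ) else 0)))), ψ ((t : ↥(unitaryGroupOfForm (starRingEnd ℂ) (Matrix.of fun i j : Fin 2 => if i.val + j.val + 1 = 2 then (1 : ℂ) else 0))) * g) ∂ρ = 1 := by
      have hmeas : Measurable (fun t : ↥(Subgroup.centralizer ({γ} : Set ↥(unitaryGroupOfForm (starRingEnd ℂ) (Matrix.of fun i j : Fin 2 => if i.val + j.val + 1 = 2 then (1 : ℂ) else 0)))) => SLAB.indicator (1 : ↥(unitaryGroupOfForm (starRingEnd ℂ) (Matrix.of fun i j : Fin 2 => if i.val + j.val + 1 = 2 then (1 : ℂ) else 0)) → ℝ≥0∞) ((t : ↥(unitaryGroupOfForm (starRingEnd ℂ) (Matrix.of fun i j : Fin 2 => if i.val + j.val + 1 = 2 then (1 : ℂ) else 0))) * g)) :=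
        (measurable_one.indicator hSLABm).comp (continuous_subtype_val.mul continuous_const).measurable
      simp only [hψ]
      rw [lintegral_const_mul _ hmeas, hind, lintegral_indicator_one hpm, hpre, measure_chi_Icc_eq hγ hz₀' hab ρ (by positivity : (0 : ℝ) < 1 / (2 * s)),
        ENNReal.inv_mul_cancel hκ0 hκtop]
    exact hcalc.symm.le
  -- THE ORBIT-BALL SET AND ITS MEASURABILITY
  set E : Set (↥(unitaryGroupOfForm (starRingEnd ℂ) (Matrix.of fun i j : Fin 2 => if i.val + j.val + 1 = 2 then (1 : ℂ) else 0)) ⧸ Subgroup.centralizer ({γ} : Set ↥(unitaryGroupOfForm (starRingEnd ℂ) (Matrix.of fun i j : Fin 2 => if i.val + j.val + 1 = 2 then (1 : ℂ) else 0)))) := {x | ∑ i : Fin 2, ∑ j : Fin 2, ‖(((x.out * γ * x.out⁻¹ : ↥(unitaryGroupOfForm (starRingEnd ℂ) (Matrix.of fun i j : Fin 2 => if i.val + j.val + 1 = 2 then (1 : ℂ) else 0))) : GL (Fin 2) ℂ) : Matrix (Fin 2) (Fin 2) ℂ) i j‖ ^ 2 ≤ R} with hE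
  have hHS : Continuous fun g : ↥(unitaryGroupOfForm (starRingEnd ℂ) (Matrix.of fun i j : Fin 2 => if i.val + j.val + 1 = 2 then (1 : ℂ) else 0)) => ∑ i : Fin 2, ∑ j : Fin 2, ‖(((g * γ * g⁻¹ : ↥(unitaryGroupOfForm (starRingEnd ℂ) (Matrix.of fun i j : Fin 2 => if i.val + j.val + 1 = 2 then (1 : ℂ) else 0))) : GL (Fin 2) ℂ) : Matrix (Fin 2) (Fin 2) ℂ) i j‖ ^ 2 := by
    have hc : Continuous fun g : ↥(unitaryGroupOfForm (starRingEnd ℂ) (Matrix.of fun i j : Fin 2 => if i.val + j.val + 1 = 2 then (1 : ℂ) else 0)) => (((g * γ * g⁻¹ : ↥(unitaryGroupOfForm (starRingEnd ℂ) (Matrix.of fun i j : Fin 2 => if i.val + j.val + 1 = 2 then (1 : ℂ) else 0))) : GL (Fin 2) ℂ) : Matrix (Fin 2) (Fin 2) ℂ) := hv.comp ((continuous_id.mul continuous_const).mul continuous_inv)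
    exact continuous_finsetSum _ fun i _ => continuous_finsetSum _ fun j _ => (((continuous_apply j).comp ((continuous_apply i).comp hc)).norm).pow 2
  have hHS' : Continuous fun g : ↥(unitaryGroupOfForm (starRingEnd ℂ) (Matrix.of fun i j : Fin 2 => if i.val + j.val + 1 = 2 then (1 : ℂ) else 0)) => ∑ i : Fin 2, ∑ j : Fin 2, ‖(((g⁻¹ * γ * g : ↥(unitaryGroupOfForm (starRingEnd ℂ) (Matrix.of fun i j : Fin 2 => if i.val + j.val + 1 = 2 then (1 : ℂ) else 0))) : GL (Fin 2) ℂ) : Matrix (Fin 2) (Fin 2) ℂ) i j‖ ^ 2 := by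
    have hc : Continuous fun g : ↥(unitaryGroupOfForm (starRingEnd ℂ) (Matrix.of fun i j : Fin 2 => if i.val + j.val + 1 = 2 then (1 : ℂ) else 0)) => (((g⁻¹ * γ * g : ↥(unitaryGroupOfForm (starRingEnd ℂ) (Matrix.of fun i j : Fin 2 => if i.val + j.val + 1 = 2 then (1 : ℂ) else 0))) : GL (Fin 2) ℂ) : Matrix (Fin 2) (Fin 2) ℂ) := hv.comp ((continuous_inv.mul continuous_const).mul continuous_id)
    exact continuous_finsetSum _ fun i _ => continuous_finsetSum _ fun j _ => (((continuous_apply j).comp ((continuous_apply i).comp hc)).norm).pow 2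
  have hEm : MeasurableSet E := by
    have hP : Measurable fun x : ↥(unitaryGroupOfForm (starRingEnd ℂ) (Matrix.of fun i j : Fin 2 => if i.val + j.val + 1 = 2 then (1 : ℂ) else 0)) ⧸ Subgroup.centralizer ({γ} : Set ↥(unitaryGroupOfForm (starRingEnd ℂ) (Matrix.of fun i j : Fin 2 => if i.val + j.val + 1 = 2 then (1 : ℂ) else 0))) => ∑ i : Fin 2, ∑ j : Fin 2, ‖(((x.out * γ * x.out⁻¹ : ↥(unitaryGroupOfForm (starRingEnd ℂ) (Matrix.of fun i j : Fin 2 => if i.val + j.val + 1 = 2 then (1 : ℂ) else 0))) : GL (Fin 2) ℂ) : Matrix (Fin 2) (Fin 2) ℂ) i j‖ ^ 2 := by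
      rw [measurable_quotient_iff (H := Subgroup.centralizer ({γ} : Set ↥(unitaryGroupOfForm (starRingEnd ℂ) (Matrix.of fun i j : Fin 2 => if i.val + j.val + 1 = 2 then (1 : ℂ) else 0)))) hT]
      have e : (fun x : ↥(unitaryGroupOfForm (starRingEnd ℂ) (Matrix.of fun i j : Fin 2 => if i.val + j.val + 1 = 2 then (1 : ℂ) else 0)) ⧸ Subgroup.centralizer ({γ} : Set ↥(unitaryGroupOfForm (starRingEnd ℂ) (Matrix.of fun i j : Fin 2 => if i.val + j.val + 1 = 2 then (1 : ℂ) else 0))) => ∑ i : Fin 2, ∑ j : Fin 2, ‖(((x.out * γ * x.out⁻¹ : ↥(unitaryGroupOfForm (starRingEnd ℂ) (Matrix.of fun i j : Fin 2 => if i.val + j.val + 1 = 2 then (1 : ℂ) else 0))) : GL (Fin 2) ℂ) : Matrix (Fin 2) (Fin 2) ℂ) i j‖ ^ 2) ∘ (QuotientGroup.mk : ↥(unitaryGroupOfForm (starRingEnd ℂ) (Matrix.of fun i j : Fin 2 => if i.val + j.val + 1 = 2 then (1 : ℂ) else 0)) → ↥(unitaryGroupOfForm (starRingEnd ℂ) (Matrix.of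 fun i j : Fin 2 => if i.val + j.val + 1 = 2 then (1 : ℂ) else 0)) ⧸ Subgroup.centralizer ({γ} : Set ↥(unitaryGroupOfForm (starRingEnd ℂ) (Matrix.of fun i j : Fin 2 => if i.val + j.val + 1 = 2 then (1 : ℂ) else 0)))) =
          fun g : ↥(unitaryGroupOfForm (starRingEnd ℂ) (Matrix.of fun i j : Fin 2 => if i.val + j.val + 1 = 2 then (1 : ℂ) else 0)) => ∑ i : Fin 2, ∑ j : Fin 2, ‖(((g * γ * g⁻¹ : ↥(unitaryGroupOfForm (starRingEnd ℂ) (Matrix.of fun i j : Fin 2 => if i.val + j.val + 1 = 2 then (1 : ℂ) else 0))) : GL (Fin 2) ℂ) : Matrix (Fin 2) (Fin 2) ℂ) i j‖ ^ 2 := by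
        funext g
        exact hs_out_conj_eq γ g
      rw [e]
      exact hHS.measurable
    exact measurableSet_le hP measurable_const
  -- STEP 1: the abstract unfolding bound with the weight `ψ`
  have step1 := quotientMeasure_le_lintegral_inv_of_one_le (Subgroup.centralizer ({γ} : Set ↥(unitaryGroupOfForm (starRingEnd ℂ) (Matrix.of fun i j : Fin 2 => if i.val + j.val + 1 = 2 then (1 : ℂ) else 0)))) ρ ν hEm hψm hfib
  -- STEP 2: the integrand is `κ⁻¹ · 1_{S'}`
  set S' : Set ↥(unitaryGroupOfForm (starRingEnd ℂ) (Matrix.of fun i j : Fin 2 => if i.val + j.val + 1 = 2 then (1 : ℂ) else 0)) := {g | ∑ i : Fin 2, ∑ j : Fin 2, ‖(((g⁻¹ * γ * g : ↥(unitaryGroupOfForm (starRingEnd ℂ) (Matrix.of fun i j : Fin 2 => if i.val + j.val + 1 = 2 then (1 : ℂ) else 0))) : GL (Fin 2) ℂ) : Matrix (Fin 2) (Fin 2) ℂ) i j‖ ^ 2 ≤ R} ∩ SLAB with hS'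
  have hS'm : MeasurableSet S' := (isClosed_le hHS' continuous_const).measurableSet.inter hSLABm
  have hint : ∫⁻ g, E.indicator 1 (QuotientGroup.mk g⁻¹ : ↥(unitaryGroupOfForm (starRingEnd ℂ) (Matrix.of fun i j : Fin 2 => if i.val + j.val + 1 = 2 then (1 : ℂ) else 0)) ⧸ Subgroup.centralizer ({γ} : Set ↥(unitaryGroupOfForm (starRingEnd ℂ) (Matrix.of fun i j : Fin 2 => if i.val + j.val + 1 = 2 then (1 : ℂ) else 0)))) * ψ g ∂ν = κ⁻¹ * ν S' := by
    have e : (fun g : ↥(unitaryGroupOfForm (starRingEnd ℂ) (Matrix.of fun i j : Fin 2 => if i.val + j.val + 1 = 2 then (1 : ℂ) else 0)) => E.indicator 1 (QuotientGroup.mk g⁻¹ : ↥(unitaryGroupOfForm (starRingEnd ℂ) (Matrix.of fun i j : Fin 2 => if i.val + j.val + 1 = 2 then (1 : ℂ) else 0)) ⧸ Subgroup.centralizer ({γ} : Set ↥(unitaryGroupOfForm (starRingEnd ℂ) (Matrix.of fun i j : Fin 2 => if i.val + j.val + 1 = 2 then (1 : ℂ) else 0)))) * ψ g) = fun g => κ⁻¹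 * S'.indicator 1 g := by
      funext g
      have hmem : ((QuotientGroup.mk g⁻¹ : ↥(unitaryGroupOfForm (starRingEnd ℂ) (Matrix.of fun i j : Fin 2 => if i.val + j.val + 1 = 2 then (1 : ℂ) else 0)) ⧸ Subgroup.centralizer ({γ} : Set ↥(unitaryGroupOfForm (starRingEnd ℂ) (Matrix.of fun i j : Fin 2 => if i.val + j.val + 1 = 2 then (1 : ℂ) else 0)))) ∈ E) ↔ ∑ i : Fin 2, ∑ j : Fin 2, ‖(((g⁻¹ * γ * g : ↥(unitaryGroupOfForm (starRingEnd ℂ) (Matrix.of fun i j : Fin 2 => if i.val + j.val + 1 = 2 then (1 : ℂ) else 0))) : GL (Fin 2) ℂ) : Matrix (Fin 2) (Fin 2) ℂ) i j‖ ^ 2 ≤ R := by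
        simp only [hE, Set.mem_setOf_eq]
        rw [hs_out_conj_eq γ g⁻¹, inv_inv]
      simp only [hψ]
      by_cases h1 : ∑ i : Fin 2, ∑ j : Fin 2, ‖(((g⁻¹ * γ * g : ↥(unitaryGroupOfForm (starRingEnd ℂ) (Matrix.of fun i j : Fin 2 => if i.val + j.val + 1 = 2 then (1 : ℂ) else 0))) : GL (Fin 2) ℂ) : Matrix (Fin 2) (Fin 2) ℂ) i j‖ ^ 2 ≤ R
      · by_cases h2 : g ∈ SLAB
        · rw [Set.indicator_of_mem (hmem.2 h1), Set.indicator_of_mem h2, Set.indicator_of_mem (show g ∈ S' from ⟨h1, h2⟩)]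
          simp
        · rw [Set.indicator_of_notMem h2, Set.indicator_of_notMem (show g ∉ S' from fun h => h2 h.2)]
          simp
      · rw [Set.indicator_of_notMem (fun h => h1 (hmem.1 h)), Set.indicator_of_notMem (show g ∉ S' from fun h => h1 h.1)]
        simp
    have hmeas : Measurable (S'.indicator (1 : ↥(unitaryGroupOfForm (starRingEnd ℂ) (Matrix.of fun i j : Fin 2 => if i.val + j.val + 1 = 2 then (1 : ℂ) else 0)) → ℝ≥0∞)) := measurable_one.indicator hS'm
    rw [e, lintegral_const_mul _ hmeas, lintegral_indicator_one hS'm]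
  exact step1.trans (le_of_eq hint)

omit [LocallyCompactSpace ↥(unitaryGroupOfForm (starRingEnd ℂ) (Matrix.of fun i j : Fin 2 => if i.val + j.val + 1 = 2 then (1 : ℂ) else 0))] [SecondCountableTopology ↥(unitaryGroupOfForm (starRingEnd ℂ) (Matrix.of fun i j : Fin 2 => if i.val + j.val + 1 = 2 then (1 : ℂ) else 0))] in
/-- **THE SLAB-BALL THROUGH THE (T2e) EXPORT**: `ν{g ∣ Σ|(g⁻¹γg)_ij|² ≤ R, ½ ≤ |g₁₀|²+|g₁₁|² ≤ 1} ≤ K · 8π√R∕|a−b|` for all `R`, with ONE `K < ∞` — the set is the preimage of a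
closed matrix set (§1), ★ `exists_measure_unitaryGroupOfForm_antidiag_two_eq_mul_prod_preimage_archPlaneLift` reads `ν` on it through the lift, and under the lift
it lies over the engine's cone ∩ slab (★ `hs_conj_lift_eq`, ★ `yOf_mem_of_slab_lift`, ★ `haarSL2pm_hsConjCone_slab_le`; `det r = 1` a.e.).
[cite: BeuzartPlessis2020Asterisque, §1.8 p. 39; §1.2 (1.2.2), (1.2.4) p. 21] -/
theorem measure_slabBall_le_of_haar
    {z₀ : ℂ} {a b : ℝ} (hγ : (((γ : ↥(unitaryGroupOfForm (starRingEnd ℂ) (Matrix.of fun i j : Fin 2 => if i.val + j.val + 1 = 2 then (1 : ℂ) else 0))) : GL (Fin 2) ℂ) : Matrix (Fin 2) (Fin 2) ℂ) = !![z₀ * a, 0; 0, z₀ * b]) (hz₀ : ‖z₀‖ = 1) (hab : a ≠ b)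
    (ν : Measure ↥(unitaryGroupOfForm (starRingEnd ℂ) (Matrix.of fun i j : Fin 2 => if i.val + j.val + 1 = 2 then (1 : ℂ) else 0))) [ν.IsHaarMeasure] :
    ∃ K : ℝ≥0∞, K ≠ ⊤ ∧ ∀ R : ℝ,
      ν ({g | ∑ i : Fin 2, ∑ j : Fin 2, ‖(((g⁻¹ * γ * g : ↥(unitaryGroupOfForm (starRingEnd ℂ) (Matrix.of fun i j : Fin 2 => if i.val + j.val + 1 = 2 then (1 : ℂ) else 0))) : GL (Fin 2) ℂ) : Matrix (Fin 2) (Fin 2) ℂ) i j‖ ^ 2 ≤ R} ∩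
           {g | 1 / 2 ≤ ‖(((g : ↥(unitaryGroupOfForm (starRingEnd ℂ) (Matrix.of fun i j : Fin 2 => if i.val + j.val + 1 = 2 then (1 : ℂ) else 0))) : GL (Fin 2) ℂ) : Matrix (Fin 2) (Fin 2) ℂ) 1 0‖ ^ 2 + ‖(((g : ↥(unitaryGroupOfForm (starRingEnd ℂ) (Matrix.of fun i j : Fin 2 => if i.val + j.val + 1 = 2 then (1 : ℂ) else 0))) : GL (Fin 2) ℂ) : Matrix (Fin 2) (Fin 2) ℂ) 1 1‖ ^ 2 ∧ ‖(((g : ↥(unitaryGroupOfForm (starRingEnd ℂ) (Matrix.of fun i j : Fin 2 => if i.val + j.val + 1 = 2 then (1 : ℂ) else 0))) : GL (Fin 2) ℂ) : Matrix (Fin 2) (Fin 2) ℂ) 1 0‖ ^ 2 + ‖(((g : ↥(unitaryGroupOfForm (starRingEnd ℂ) (Matrix.of fun i j : Fin 2 => if i.val + j.val + 1 = 2 then (1 : ℂ) else 0))) : GL (Fin 2) ℂ) : Matrix (Fin 2) (Fin 2) ℂ) 1 1‖ ^ 2 ≤ 1}) ≤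
        K * ENNReal.ofReal (8 * π * Real.sqrt R / |a - b|) := by
  haveI : SFinite (iwasawaMeasure : Measure (Matrix (Fin 2) (Fin 2) ℝ)) := by
    unfold iwasawaMeasure; infer_instance
  set μc : Measure Circle := Measure.haar with hμc
  obtain ⟨κ, hκ0, hκtop, hS⟩ := exists_measure_unitaryGroupOfForm_antidiag_two_eq_mul_prod_preimage_archPlaneLift μc ν
  have hμcfin : μc univ < ⊤ := IsCompact.measure_lt_top isCompact_univ
  refine ⟨κ * μc univ, ENNReal.mul_ne_top hκtop hμcfin.ne, fun R => ?_⟩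
  -- the matrix set
  set Smat : Set (Matrix (Fin 2) (Fin 2) ℂ) :=
    {M | ∑ i : Fin 2, ∑ j : Fin 2, ‖(((Matrix.of fun i j : Fin 2 => if i.val + j.val + 1 = 2 then (1 : ℂ) else 0) * (M.map (starRingEnd ℂ))ᵀ * (Matrix.of fun i j : Fin 2 => if i.val + j.val + 1 = 2 then (1 : ℂ) else 0) * (((γ : ↥(unitaryGroupOfForm (starRingEnd ℂ) (Matrix.of fun i j : Fin 2 => if i.val + j.val + 1 = 2 then (1 : ℂ) else 0))) : GL (Fin 2) ℂ) : Matrix (Fin 2) (Fin 2) ℂ) * M : Matrix (Fin 2) (Fin 2) ℂ)) i j‖ ^ 2 ≤ R ∧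
      (1 / 2 ≤ ‖M 1 0‖ ^ 2 + ‖M 1 1‖ ^ 2 ∧ ‖M 1 0‖ ^ 2 + ‖M 1 1‖ ^ 2 ≤ 1)} with hSmat
  have hFc : Continuous fun M : Matrix (Fin 2) (Fin 2) ℂ =>
      ∑ i : Fin 2, ∑ j : Fin 2, ‖(((Matrix.of fun i j : Fin 2 => if i.val + j.val + 1 = 2 then (1 : ℂ) else 0) * (M.map (starRingEnd ℂ))ᵀ * (Matrix.of fun i j : Fin 2 => if i.val + j.val + 1 = 2 then (1 : ℂ) else 0) * (((γ : ↥(unitaryGroupOfForm (starRingEnd ℂ) (Matrix.of fun i j : Fin 2 => if i.val + j.val + 1 = 2 then (1 : ℂ) else 0))) : GL (Fin 2) ℂ) : Matrix (Fin 2) (Fin 2) ℂ) * M : Matrix (Fin 2) (Fin 2) ℂ)) i j‖ ^ 2 := by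
    have hM : Continuous fun M : Matrix (Fin 2) (Fin 2) ℂ => (Matrix.of fun i j : Fin 2 => if i.val + j.val + 1 = 2 then (1 : ℂ) else 0) * (M.map (starRingEnd ℂ))ᵀ * (Matrix.of fun i j : Fin 2 => if i.val + j.val + 1 = 2 then (1 : ℂ) else 0) * (((γ : ↥(unitaryGroupOfForm (starRingEnd ℂ) (Matrix.of fun i j : Fin 2 => if i.val + j.val + 1 = 2 then (1 : ℂ) else 0))) : GL (Fin 2) ℂ) : Matrix (Fin 2) (Fin 2) ℂ) * M :=
      (((continuous_const.matrix_mul ((continuous_id.matrix_map Complex.continuous_conj).matrix_transpose)).matrix_mul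
        continuous_const).matrix_mul continuous_const).matrix_mul continuous_id
    exact continuous_finsetSum _ fun i _ => continuous_finsetSum _ fun j _ => ((hM.matrix_elem i j).norm).pow 2
  have hrowc : Continuous fun M : Matrix (Fin 2) (Fin 2) ℂ => ‖M 1 0‖ ^ 2 + ‖M 1 1‖ ^ 2 :=
    (((continuous_id.matrix_elem 1 0).norm).pow 2).add (((continuous_id.matrix_elem 1 1).norm).pow 2)
  have hSmatm : MeasurableSet Smat :=
    ((isClosed_le hFc continuous_const).inter ((isClosed_le continuous_const hrowc).inter (isClosed_le hrowc continuous_const))).measurableSet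
  -- the slab-ball is its preimage
  have hpreim : ({g : ↥(unitaryGroupOfForm (starRingEnd ℂ) (Matrix.of fun i j : Fin 2 => if i.val + j.val + 1 = 2 then (1 : ℂ) else 0)) | ∑ i : Fin 2, ∑ j : Fin 2, ‖(((g⁻¹ * γ * g : ↥(unitaryGroupOfForm (starRingEnd ℂ) (Matrix.of fun i j : Fin 2 => if i.val + j.val + 1 = 2 then (1 : ℂ) else 0))) : GL (Fin 2) ℂ) : Matrix (Fin 2) (Fin 2) ℂ) i j‖ ^ 2 ≤ R} ∩
        {g | 1 / 2 ≤ ‖(((g : ↥(unitaryGroupOfForm (starRingEnd ℂ) (Matrix.of fun i j : Fin 2 => if i.val + j.val + 1 = 2 then (1 : ℂ) else 0))) : GL (Fin 2) ℂ) : Matrix (Fin 2) (Fin 2) ℂ) 1 0‖ ^ 2 + ‖(((g : ↥(unitaryGroupOfForm (starRingEnd ℂ) (Matrix.of fun i j : Fin 2 => if i.val + j.val + 1 = 2 then (1 : ℂ) else 0))) : GL (Fin 2) ℂ) : Matrix (Fin 2) (Fin 2) ℂ) 1 1‖ ^ 2 ∧ ‖(((g : ↥(unitaryGroupOfForm (starRingEnd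 ℂ) (Matrix.of fun i j : Fin 2 => if i.val + j.val + 1 = 2 then (1 : ℂ) else 0))) : GL (Fin 2) ℂ) : Matrix (Fin 2) (Fin 2) ℂ) 1 0‖ ^ 2 + ‖(((g : ↥(unitaryGroupOfForm (starRingEnd ℂ) (Matrix.of fun i j : Fin 2 => if i.val + j.val + 1 = 2 then (1 : ℂ) else 0))) : GL (Fin 2) ℂ) : Matrix (Fin 2) (Fin 2) ℂ) 1 1‖ ^ 2 ≤ 1}) =
      {g : ↥(unitaryGroupOfForm (starRingEnd ℂ) (Matrix.of fun i j : Fin 2 => if i.val + j.val + 1 = 2 then (1 : ℂ) else 0)) | (((g : ↥(unitaryGroupOfForm (starRingEnd ℂ) (Matrix.of fun i j : Fin 2 => if i.val + j.val + 1 = 2 then (1 : ℂ) else 0))) : GL (Fin 2) ℂ) : Matrix (Fin 2) (Fin 2) ℂ) ∈ Smat} := by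
    ext g
    simp only [Set.mem_inter_iff, Set.mem_setOf_eq, hSmat, hs_inv_conj_eq_sandwich g]
  rw [hpreim, hS Smat hSmatm]
  -- under the lift: over the engine's cone ∩ slab up to the null set `det r ≠ 1`
  set A : Set (Matrix (Fin 2) (Fin 2) ℝ) :=
    {r | r.det = 1 ∧ ∑ i : Fin 2, ∑ j : Fin 2, (r⁻¹ * !![a, 0; 0, b] * r) i j ^ 2 ≤ R ∧ 1 ≤ yOf r ∧ yOf r ≤ 2} with hA
  have hsub : {p : Circle × Matrix (Fin 2) (Fin 2) ℝ | archPlaneLift (p.1 : ℂ) p.2 ∈ Smat} ⊆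
      (univ : Set Circle) ×ˢ A ∪ (univ : Set Circle) ×ˢ {r : Matrix (Fin 2) (Fin 2) ℝ | r.det = 1}ᶜ := by
    intro p hp
    by_cases hdet : p.2.det = 1
    · left
      have hcoe : (((archPlaneLiftUnitary (p.1, p.2) : ↥(unitaryGroupOfForm (starRingEnd ℂ) (Matrix.of fun i j : Fin 2 => if i.val + j.val + 1 = 2 then (1 : ℂ) else 0))) : GL (Fin 2) ℂ) : Matrix (Fin 2) (Fin 2) ℂ) = archPlaneLift (p.1 : ℂ) p.2 :=
        coe_archPlaneLiftUnitary (p := (p.1, p.2)) hdet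
      simp only [Set.mem_setOf_eq, hSmat] at hp
      rw [← hcoe, ← hs_inv_conj_eq_sandwich, hs_conj_lift_eq hγ hz₀ p.1 hdet] at hp
      refine ⟨mem_univ _, hdet, hp.1, ?_⟩
      exact yOf_mem_of_slab_lift p.1 hdet hp.2.1 hp.2.2
    · right
      exact ⟨mem_univ _, hdet⟩
  calc κ * (μc.prod iwasawaMeasure) {p : Circle × Matrix (Fin 2) (Fin 2) ℝ | archPlaneLift (p.1 : ℂ) p.2 ∈ Smat}
      ≤ κ * (μc.prod iwasawaMeasure) ((univ : Set Circle) ×ˢ A ∪ (univ : Set Circle) ×ˢ {r : Matrix (Fin 2) (Fin 2) ℝ | r.det = 1}ᶜ) := by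
        gcongr
    _ ≤ κ * ((μc.prod iwasawaMeasure) ((univ : Set Circle) ×ˢ A) +
          (μc.prod iwasawaMeasure) ((univ : Set Circle) ×ˢ {r : Matrix (Fin 2) (Fin 2) ℝ | r.det = 1}ᶜ)) := by
        gcongr; exact measure_union_le _ _
    _ = κ * (μc univ * iwasawaMeasure A) := by
        rw [Measure.prod_prod, Measure.prod_prod, iwasawaMeasure_compl_det_one, mul_zero, add_zero]
    _ ≤ κ * (μc univ * haarSL2pm A) := mul_le_mul' le_rfl (mul_le_mul' le_rfl (iwasawaMeasure_le_haarSL2pm A))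
    _ ≤ κ * (μc univ * ENNReal.ofReal (8 * π * Real.sqrt R / |a - b|)) :=
        mul_le_mul' le_rfl (mul_le_mul' le_rfl (haarSL2pm_hsConjCone_slab_le hab R))
    _ = κ * μc univ * ENNReal.ofReal (8 * π * Real.sqrt R / |a - b|) := (mul_assoc _ _ _).symm

/-- **THE QUOTIENT VOLUME OF A SPLIT REGULAR ORBIT HS-BALL GROWS LIKE `√R` — UNCONDITIONAL** (the (T2e) identification consumed BY NAME): `∃ C, ∀ R,
μ_{G⧸T} {x̄ ∣ Σ|(x̄.out γ x̄.out⁻¹)_ij|² ≤ R} ≤ C √R` for `γ = diag(z₀a, z₀b)`, `|z₀| = 1`, `a ≠ b`, any Haar frame `ν` (right∕inversion invariant), `ρ` (inversion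
invariant). [cite: BeuzartPlessis2020Asterisque, §1.8 p. 39; §1.2 (1.2.2), (1.2.4) p. 21] [cite: Folland1995, §2.6 Thm. 2.49] -/
theorem exists_quotientMeasure_hsOrbitBall_le_sqrt_of_split_haar
    {z₀ : ℂ} {a b : ℝ} (hγ : (((γ : ↥(unitaryGroupOfForm (starRingEnd ℂ) (Matrix.of fun i j : Fin 2 => if i.val + j.val + 1 = 2 then (1 : ℂ) else 0))) : GL (Fin 2) ℂ) : Matrix (Fin 2) (Fin 2) ℂ) = !![z₀ * a, 0; 0, z₀ * b]) (hz₀ : ‖z₀‖ = 1) (hab : a ≠ b)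
    (ν : Measure ↥(unitaryGroupOfForm (starRingEnd ℂ) (Matrix.of fun i j : Fin 2 => if i.val + j.val + 1 = 2 then (1 : ℂ) else 0))) [ν.IsHaarMeasure] [ν.IsMulRightInvariant] [ν.IsInvInvariant]
    (ρ : Measure ↥(Subgroup.centralizer ({γ} : Set ↥(unitaryGroupOfForm (starRingEnd ℂ) (Matrix.of fun i j : Fin 2 => if i.val + j.val + 1 = 2 then (1 : ℂ) else 0))))) [ρ.IsHaarMeasure] [ρ.IsInvInvariant]
    [MeasurableSpace (↥(unitaryGroupOfForm (starRingEnd ℂ) (Matrix.of fun i j : Fin 2 => if i.val + j.val + 1 = 2 then (1 : ℂ) else 0)) ⧸ Subgroup.centralizer ({γ} : Set ↥(unitaryGroupOfForm (starRingEnd ℂ) (Matrix.of fun i j : Fin 2 => if i.val + j.val + 1 = 2 then (1 : ℂ) else 0))))] [BorelSpace (↥(unitaryGroupOfForm (starRingEnd ℂ) (Matrix.of fun i j : Fin 2 => if i.val + j.val + 1 = 2 then (1 : ℂ) else 0)) ⧸ Subgroup.centralizer ({γ} : Set ↥(unitaryGroupOfForm (starRingEnd ℂ) (Matrix.of fun i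 j : Fin 2 => if i.val + j.val + 1 = 2 then (1 : ℂ) else 0))))] :
    ∃ C : ℝ, ∀ R : ℝ, quotientMeasure (Subgroup.centralizer ({γ} : Set ↥(unitaryGroupOfForm (starRingEnd ℂ) (Matrix.of fun i j : Fin 2 => if i.val + j.val + 1 = 2 then (1 : ℂ) else 0)))) ρ (Set.isClosed_centralizer ({γ} : Set ↥(unitaryGroupOfForm (starRingEnd ℂ) (Matrix.of fun i j : Fin 2 => if i.val + j.val + 1 = 2 then (1 : ℂ) else 0)))) ν
        {x | ∑ i : Fin 2, ∑ j : Fin 2, ‖(((x.out * γ * x.out⁻¹ : ↥(unitaryGroupOfForm (starRingEnd ℂ) (Matrix.of fun i j : Fin 2 => if i.val + j.val + 1 = 2 then (1 : ℂ) else 0))) : GL (Fin 2) ℂ) : Matrix (Fin 2) (Fin 2) ℂ) i j‖ ^ 2 ≤ R} ≤ ENNReal.ofReal (C * Real.sqrt R) := by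
  have hz₀' : z₀ ≠ 0 := by
    intro h; rw [h, norm_zero] at hz₀; exact zero_ne_one hz₀
  obtain ⟨K, hKtop, hK⟩ := measure_slabBall_le_of_haar hγ hz₀ hab ν
  set κT : ℝ≥0∞ := ρ {t | ‖(((((t : ↥(Subgroup.centralizer ({γ} : Set ↥(unitaryGroupOfForm (starRingEnd ℂ) (Matrix.of fun i j : Fin 2 => if i.val + j.val + 1 = 2 then (1 : ℂ) else 0))))) : ↥(unitaryGroupOfForm (starRingEnd ℂ) (Matrix.of fun i j : Fin 2 => if i.val + j.val + 1 = 2 then (1 : ℂ) else 0))) : ↥(unitaryGroupOfForm (starRingEnd ℂ) (Matrix.of fun i j : Fin 2 => if i.val + j.val + 1 = 2 then (1 : ℂ) else 0))) : GL (Fin 2) ℂ) : Matrix (Fin 2) (Fin 2) ℂ) 1 1‖ ^ 2 ∈ Icc 1 2} with hκT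
  have hκT0 : κT ≠ 0 := measure_chi_Icc_ne_zero hγ ρ
  have hfin : κT⁻¹ * K ≠ ⊤ := ENNReal.mul_ne_top (ENNReal.inv_ne_top.2 hκT0) hKtop
  refine ⟨(κT⁻¹ * K).toReal * (8 * π / |a - b|), fun R => ?_⟩
  calc quotientMeasure (Subgroup.centralizer ({γ} : Set ↥(unitaryGroupOfForm (starRingEnd ℂ) (Matrix.of fun i j : Fin 2 => if i.val + j.val + 1 = 2 then (1 : ℂ) else 0)))) ρ (Set.isClosed_centralizer ({γ} : Set ↥(unitaryGroupOfForm (starRingEnd ℂ) (Matrix.of fun i j : Fin 2 => if i.val + j.val + 1 = 2 then (1 : ℂ) else 0)))) ν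
          {x | ∑ i : Fin 2, ∑ j : Fin 2, ‖(((x.out * γ * x.out⁻¹ : ↥(unitaryGroupOfForm (starRingEnd ℂ) (Matrix.of fun i j : Fin 2 => if i.val + j.val + 1 = 2 then (1 : ℂ) else 0))) : GL (Fin 2) ℂ) : Matrix (Fin 2) (Fin 2) ℂ) i j‖ ^ 2 ≤ R}
      ≤ κT⁻¹ * ν ({g | ∑ i : Fin 2, ∑ j : Fin 2, ‖(((g⁻¹ * γ * g : ↥(unitaryGroupOfForm (starRingEnd ℂ) (Matrix.of fun i j : Fin 2 => if i.val + j.val + 1 = 2 then (1 : ℂ) else 0))) : GL (Fin 2) ℂ) : Matrix (Fin 2) (Fin 2) ℂ) i j‖ ^ 2 ≤ R} ∩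
           {g | 1 / 2 ≤ ‖(((g : ↥(unitaryGroupOfForm (starRingEnd ℂ) (Matrix.of fun i j : Fin 2 => if i.val + j.val + 1 = 2 then (1 : ℂ) else 0))) : GL (Fin 2) ℂ) : Matrix (Fin 2) (Fin 2) ℂ) 1 0‖ ^ 2 + ‖(((g : ↥(unitaryGroupOfForm (starRingEnd ℂ) (Matrix.of fun i j : Fin 2 => if i.val + j.val + 1 = 2 then (1 : ℂ) else 0))) : GL (Fin 2) ℂ) : Matrix (Fin 2) (Fin 2) ℂ) 1 1‖ ^ 2 ∧ ‖(((g : ↥(unitaryGroupOfForm (starRingEnd ℂ) (Matrix.of fun i j : Fin 2 => if i.val + j.val + 1 = 2 then (1 : ℂ) else 0))) : GL (Fin 2) ℂ) : Matrix (Fin 2) (Fin 2) ℂ) 1 0‖ ^ 2 + ‖(((g : ↥(unitaryGroupOfForm (starRingEnd ℂ) (Matrix.of fun i j : Fin 2 => if i.val + j.val + 1 = 2 then (1 : ℂ) else 0))) : GL (Fin 2) ℂ) : Matrix (Fin 2) (Fin 2) ℂ) 1 1‖ ^ 2 ≤ 1}) :=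
        quotientMeasure_hsOrbitBall_le_inv_mul_measure_slabBall hγ hz₀ hab ν ρ R
    _ ≤ κT⁻¹ * (K * ENNReal.ofReal (8 * π * Real.sqrt R / |a - b|)) := by gcongr; exact hK R
    _ = (κT⁻¹ * K) * ENNReal.ofReal (8 * π * Real.sqrt R / |a - b|) := (mul_assoc _ _ _).symm
    _ = ENNReal.ofReal ((κT⁻¹ * K).toReal * (8 * π / |a - b|) * Real.sqrt R) := by
        rw [mul_assoc ((κT⁻¹ * K).toReal), ENNReal.ofReal_mul ENNReal.toReal_nonneg, ENNReal.ofReal_toReal hfin]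
        congr 2
        ring

end Head

end Literature.NumberTheory.Rogawski1990

end
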